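import Summits.QuantumFields.BalabanUV.T4Continuum.Support.NE7FlatGradientModulusPrep
import HarnessLib

/-!
# NE7FlatGradientModulusCompact — THE FLAT C¹ COMPACT LETTER, PART (ii): THE LOG-LIPSCHITZ MODULUS OF THE GRADIENT. For a flat (`U = 1`) matrix-valued
# bond field `Z` supported in a cube of radius `R`, the bond increment `∇_μZ_κ(x) = Z(x + e_μ, κ) − Z(x, κ)` satisfies
# `‖∇_μZ_κ(x) − ∇_μZ_κ(x′)‖ ≤ C(d)·h·(1 + log⁺((R + 1)∕h))·(B′ + D′)`, `h = |x − x′|_∞`, with `B′ ≥ sup‖∇(curlAt 1 Z)‖`, `D′ ≥ sup‖∇(flatDiv Z)‖`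
# (INTERFACE REQUEST NE7 stub (S-c), second half; sequel of `NE7FlatGradientLetterCompact`)

Cell `pub-balaban`, rung (B)+1 sub-cell t4; written by the row-NE7b OWNER lineage `b2b-balaban-t4-ne7b-p1` (gen 154) for the sibling crux row NE7
(lineage `t4-ne7-p1`, gen 106's INTERFACE REQUEST NE7 stub (S-c), `HOME/INBOX.md` [NE7P1-G106-INBOX-2], memo `t4/b2b-balaban-t4-ne7-p1-g106/ROAD-G106.md` §4:
«(ii) the modulus companion `‖∇Z(x) − ∇Z(x′)‖ ≤ C·|x − x′|·(1 + log(M N′∕|x − x′|))·(same data)` (second differences of the kernel off the diagonal)»).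
THE MECHANISM ([folklore] discrete potential theory over pv23's `Beta/PoissonInterior`, KERNEL).  With `K = dG₀ μ` the dipole kernel (`|K(v)| ≤ C₁·nrm(v)^{1−d}`,
`G₀_diff_bound`) and the Green representation of `f ∘ Z_κ` for a real functional `f` (part (i)): `f(∇_μZ_κ(x) − ∇_μZ_κ(x′)) = −Σ_y [K(x−y) − K(x′−y)]·Δ(f∘Z_κ)(y)`,
`|Δ(f∘Z_κ)| ≤ ‖f‖·(d·B′ + D′)` (`norm_lapVec_le`, `lap_dual_apply`).  NEAR FIELD `|x′ − y|_∞ < 2h`: both kernels separately, two dipole row sums over cubes of radius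
`2h`, `3h` (`sum_cube_inv_nrm_pow_le`: one power of the radius) — `O(h)`.  FAR FIELD `|x′ − y|_∞ ≥ 2h`: `|K(v + w) − K(v)| ≤ |w|₁·C₂·2^d·nrm(v)^{−d}`
(`abs_dG₀_add_sub_le`: the unit second differences `G₀_diff2_bound` telescoped along an ℓ¹ lattice path from `v` to `v + w`, every point of which has `nrm ≥ nrm(v)∕2`),
summed over the shells `2h ≤ |z|_∞ ≤ 3R + 3`: `Σ nrm^{−d} ≤ 2d·3^{d−1}·Σ_{j} 1∕j ≤ 2d·3^{d−1}·(1 + log⁺((3R+3)∕(2h)))` (`sum_cube_far_inv_nrm_pow_le`, the harmonic tail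
`sum_Icc_inv_le_log`) — `O(h·(1 + log⁺((R+1)∕h)))`.  When `x′` is farther than `2R + 2` from the centre both increments vanish unless `h > R + 1`, where part (i) suffices.
WHAT ([folklore]; 0 def, 0 sorry; every `d ≥ 3`; constants existential in `d`; the bricks — harmonic tail, logarithmic shell sum `sum_cube_far_inv_nrm_pow_le`, re-indexing
`sum_reflect_le`, kernel differences `abs_dG₀_add_sub_le`, `posLog_three_halves_mul_le` — are `NE7FlatGradientModulusPrep`'s).  **`gradient_modulus_cube`** — `∃ C ≥ 0` (a function of `d`):
`Z` vanishing off `PoissonInterior.cube c R`, `B′ ≥ 0` with `‖curlAt 1 Z (z + e_λ) μ ν − curlAt 1 Z z μ ν‖ ≤ B′` (`μ ≠ ν`), `D′` with `‖flatDiv Z (x + e_λ) − flatDiv Z x‖ ≤ D′`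
⟹ for all `x x′ μ κ`, `h := |x − x′|_∞`:  `‖(Z (x+e_μ) κ − Z x κ) − (Z (x′+e_μ) κ − Z x′ κ)‖ ≤ C·h·(1 + log⁺((R+1)∕h))·(B′ + D′)` (`log⁺ = Real.posLog`; at `h = 0` both
sides vanish; for `1 ≤ h ≤ R + 1`, `log⁺ = log`).
HONEST FRAMING (page 1): `U = 1`, linear, flat; a JUNCTION over pv23's potential theory; NOT the curved C¹ letter, NOT the (Lip₁ᶜ)(Höl½ᶜ) supplier, NOT NE7, nothing of row
NE7b (`T4WeightBudget.RelWeightBound` NOT PRINTED ∕ NOT PROVED); nothing of Bałaban's asserted; spine count = dagwriter∕referees' call; finite T⁴ rung (B)+1 — NOT infinite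
volume, NOT mass gap, NOT BetaPertH, NOT Clay.  Continuum YM on T⁴ ⇐ BetaPertH ∧ nine spine estimates (0/9 proved); BetaPertH ⇐ (D1) ∧ (D4) ∧ CAP+tail; G-an2-4 gates
asym, D1 and NE2/3/4.
-/

set_option autoImplicit false

open scoped BigOperators Matrix.Norms.L2Operator
open Finset

namespace Summit.QuantumFields.BalabanUV.T4Continuum.NE7FlatGradientModulusCompact

open Literature.MathematicalPhysics.QuantumFieldTheory.Balaban1983to89
open B7Prop1Explicit (Site e)
open T4AveragingDeficitWall (curlAt)
open BlockAveragePushDirSplit (flat)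
open NE3CoercivityScaling (flatDiv)
open Literature.Probability.LatticeModels (latticeLaplacianZd)
open Beta.PoissonInterior (cube mem_cube cube_mono mem_cube_zero_iff supNorm supNorm_le_iff natAbs_le_supNorm supNorm_eq_zero_iff
  supNorm_add_le supNorm_neg nrm nrm_pos one_le_nrm supNorm_le_nrm G₀ dG₀ G₀_diff_bound G₀_diff2_bound green_rep sum_cube_inv_nrm_pow_le
  card_shell_le)
open NE7FlatGradientLetterCompact (norm_lapVec_le lap_dual_apply mem_cube_succ_of_add_e gradient_letter_cube)
open NE7FlatGradientModulusPrep (posLog_three_halves_mul_le sum_reflect_le sum_cube_far_inv_nrm_pow_le abs_dG₀_add_sub_le)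

noncomputable section

variable {d : ℕ} {n : Type*} [Fintype n] [DecidableEq n]

/-! ## The log-Lipschitz modulus of the gradient -/

/-- **THE FLAT C¹ COMPACT LETTER, PART (ii): LOG-LIPSCHITZ MODULUS OF THE GRADIENT** (`d ≥ 3`): `∃ C ≥ 0` (a function of `d`) such that for every cube
`cube c R`, every bond field `Z` vanishing off it, every `B′ ≥ 0` bounding `‖curlAt 1 Z (z + e_λ) μ ν − curlAt 1 Z z μ ν‖` (`μ ≠ ν`), every `D′` bounding
`‖flatDiv Z (x + e_λ) − flatDiv Z x‖`, and all `x, x′, μ, κ` (`h := |x − x′|_∞`):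
`‖(Z (x+e_μ) κ − Z x κ) − (Z (x′+e_μ) κ − Z x′ κ)‖ ≤ C·h·(1 + log⁺((R+1)∕h))·(B′ + D′)`. [folklore] -/
theorem gradient_modulus_cube (hd : 3 ≤ d) : ∃ C : ℝ, 0 ≤ C ∧
    ∀ (c : Site d) (R : ℕ) (Z : Site d → Fin d → Matrix n n ℂ), (∀ x, x ∉ cube c R → Z x = 0) →
      ∀ (B' : ℝ), 0 ≤ B' → (∀ (z : Site d) (lam μ ν : Fin d), μ ≠ ν →
        ‖curlAt (flat (d := d) (n := n)) Z (z + e lam) μ ν - curlAt (flat (d := d) (n := n)) Z z μ ν‖ ≤ B') →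
      ∀ (D' : ℝ), (∀ (x : Site d) (lam : Fin d), ‖flatDiv Z (x + e lam) - flatDiv Z x‖ ≤ D') →
      ∀ (x x' : Site d) (μ κ : Fin d),
        ‖(Z (x + e μ) κ - Z x κ) - (Z (x' + e μ) κ - Z x' κ)‖
          ≤ C * (supNorm (x - x') : ℝ) * (1 + Real.posLog (((R : ℝ) + 1) / supNorm (x - x'))) * (B' + D') := by
  obtain ⟨C₁, hC₁, hG⟩ := G₀_diff_bound hd
  obtain ⟨C₂, hC₂, hK⟩ := abs_dG₀_add_sub_le hd
  obtain ⟨Cg, hCg, hgrad⟩ := gradient_letter_cube (d := d) (n := n) hd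
  have hd0 : 0 < d := by omega
  have hd1 : (1 : ℝ) ≤ d := by exact_mod_cast hd0
  have hA0 : (0 : ℝ) ≤ 2 * d * 3 ^ (d - 1) := by positivity
  -- the constant: near field `C₁(2 + 5A)`, far field `2·d·C₂·2^d·A`, times `d` for `dB′ + D′ ≤ d(B′ + D′)`, plus part (i)'s `Cg`
  refine ⟨(C₁ * (2 + 5 * (2 * d * 3 ^ (d - 1))) + 2 * d * (C₂ * 2 ^ d) * (2 * d * 3 ^ (d - 1))) * d + Cg, by positivity,
    fun c R Z hZ B' hB0 hB D' hD x x' μ κ => ?_⟩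
  have hD0 : 0 ≤ D' := (norm_nonneg _).trans (hD x μ)
  have hBD : 0 ≤ B' + D' := by positivity
  have hS0 : 0 ≤ (d : ℝ) * B' + D' := by positivity
  have hlog0 : 0 ≤ Real.posLog (((R : ℝ) + 1) / (supNorm (x - x') : ℝ)) := Real.posLog_nonneg
  have hrhs0 : 0 ≤ ((C₁ * (2 + 5 * (2 * d * 3 ^ (d - 1))) + 2 * d * (C₂ * 2 ^ d) * (2 * d * 3 ^ (d - 1))) * d + Cg)
      * (supNorm (x - x') : ℝ) * (1 + Real.posLog (((R : ℝ) + 1) / (supNorm (x - x') : ℝ))) * (B' + D') := by positivity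
  -- an increment vanishes outside `cube c (R+1)`
  have hvan : ∀ y, y ∉ cube c (R + 1) → Z (y + e μ) κ - Z y κ = 0 := by
    intro y hy
    have h1 : Z y = 0 := hZ y fun h => hy (cube_mono (Nat.le_succ R) h)
    have h2 : Z (y + e μ) = 0 := hZ (y + e μ) fun h => hy (mem_cube_succ_of_add_e h)
    simp only [h1, h2, Pi.zero_apply, sub_self]
  -- `h = 0`
  rcases Nat.eq_zero_or_pos (supNorm (x - x')) with hh0 | hh1
  · have hxx : x = x' := sub_eq_zero.1 (supNorm_eq_zero_iff.1 hh0)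
    subst hxx
    simp only [sub_self, norm_zero] at hrhs0 ⊢
    exact hrhs0
  have hh1r : (1 : ℝ) ≤ supNorm (x - x') := by exact_mod_cast hh1
  -- Case II: `x′` farther than `2R + 2` from the centre
  by_cases hfar : 2 * R + 2 < supNorm (x' - c)
  · have hx'out : x' ∉ cube c (R + 1) := fun hmem => by
      have := (Beta.PoissonInterior.mem_cube_iff_supNorm).1 hmem
      omega
    rw [hvan x' hx'out, sub_zero]
    by_cases hhR : supNorm (x - x') ≤ R + 1
    · -- then `x` is outside too
      have hxout : x ∉ cube c (R + 1) := fun hmem => by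
        have h1 := (Beta.PoissonInterior.mem_cube_iff_supNorm).1 hmem
        have h2 : supNorm (x' - c) ≤ supNorm (x' - x) + supNorm (x - c) := by
          simpa using supNorm_add_le (x' - x) (x - c)
        have h3 : supNorm (x' - x) = supNorm (x - x') := by rw [← supNorm_neg, neg_sub]
        omega
      rw [hvan x hxout, norm_zero]
      exact hrhs0
    · -- `h > R + 1`: part (i) suffices
      have hRh : (R : ℝ) + 1 ≤ supNorm (x - x') := by exact_mod_cast (by omega : R + 1 ≤ supNorm (x - x'))
      calc ‖Z (x + e μ) κ - Z x κ‖ ≤ Cg * ((R : ℝ) + 1) * (B' + D') := hgrad c R Z hZ B' hB0 hB D' hD x μ κ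
        _ ≤ Cg * (supNorm (x - x') : ℝ) * (1 + Real.posLog (((R : ℝ) + 1) / (supNorm (x - x') : ℝ))) * (B' + D') := by
            apply mul_le_mul_of_nonneg_right _ hBD
            calc Cg * ((R : ℝ) + 1) ≤ Cg * (supNorm (x - x') : ℝ) := mul_le_mul_of_nonneg_left hRh hCg
              _ = Cg * (supNorm (x - x') : ℝ) * 1 := (mul_one _).symm
              _ ≤ Cg * (supNorm (x - x') : ℝ) * (1 + Real.posLog (((R : ℝ) + 1) / (supNorm (x - x') : ℝ))) :=
                  mul_le_mul_of_nonneg_left (by linarith) (by positivity)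
        _ ≤ _ := by
            apply mul_le_mul_of_nonneg_right _ hBD
            apply mul_le_mul_of_nonneg_right _ (by positivity)
            apply mul_le_mul_of_nonneg_right _ (by positivity)
            have : 0 ≤ (C₁ * (2 + 5 * (2 * d * 3 ^ (d - 1))) + 2 * d * (C₂ * 2 ^ d) * (2 * d * 3 ^ (d - 1))) * d := by positivity
            linarith
  -- Case I: `|x′ − c|_∞ ≤ 2R + 2`
  rw [not_lt] at hfar
  set h : ℕ := supNorm (x - x') with hhdef
  set T := cube c (R + 1) with hTdef
  -- the displacement and its ℓ¹ norm
  set w : Site d := x - x' with hwdef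
  have hwi : ∀ i, |w i| ≤ (h : ℤ) := fun i => by
    have := natAbs_le_supNorm w i
    have h1 : ((w i).natAbs : ℤ) = |w i| := Int.natCast_natAbs (w i)
    omega
  obtain ⟨m, hm⟩ : ∃ m : ℕ, (∑ i, |w i| : ℤ) = m := ⟨(∑ i, |w i|).toNat, (Int.toNat_of_nonneg (Finset.sum_nonneg fun i _ => abs_nonneg _)).symm⟩
  have hmd : (m : ℝ) ≤ d * h := by
    have : (m : ℤ) ≤ d * h := by
      rw [← hm]
      calc (∑ i, |w i| : ℤ) ≤ ∑ _i : Fin d, (h : ℤ) := Finset.sum_le_sum fun i _ => hwi i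
        _ = d * h := by simp
    exact_mod_cast this
  -- FAR FIELD: `2h ≤ |x′ − y|_∞`
  have hfar_pt : ∀ y ∈ T.filter (fun y => 2 * h ≤ supNorm (x' - y)),
      |dG₀ μ (x - y) - dG₀ μ (x' - y)| ≤ d * h * (C₂ * 2 ^ d / nrm (x' - y) ^ d) := by
    intro y hy
    rw [Finset.mem_filter] at hy
    have hxy : x - y = (x' - y) + w := by rw [hwdef]; abel
    have hsup : 2 * (supNorm w : ℝ) ≤ nrm (x' - y) := by
      calc 2 * (supNorm w : ℝ) = ((2 * h : ℕ) : ℝ) := by rw [hwdef, hhdef]; push_cast; ring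
        _ ≤ supNorm (x' - y) := by exact_mod_cast hy.2
        _ ≤ nrm (x' - y) := supNorm_le_nrm _
    rw [hxy]
    calc |dG₀ μ (x' - y + w) - dG₀ μ (x' - y)| ≤ m * (C₂ * 2 ^ d / nrm (x' - y) ^ d) := hK μ m (x' - y) w hm hsup
      _ ≤ d * h * (C₂ * 2 ^ d / nrm (x' - y) ^ d) :=
          mul_le_mul_of_nonneg_right hmd (div_nonneg (by positivity) (pow_nonneg (nrm_pos _).le _))
  have hfar_sum : ∑ y ∈ T.filter (fun y => 2 * h ≤ supNorm (x' - y)), |dG₀ μ (x - y) - dG₀ μ (x' - y)|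
      ≤ d * h * (C₂ * 2 ^ d) * (2 * d * 3 ^ (d - 1) * (1 + Real.posLog (((3 * R + 3 : ℕ) : ℝ) / ((2 * h : ℕ) : ℝ)))) := by
    calc ∑ y ∈ T.filter (fun y => 2 * h ≤ supNorm (x' - y)), |dG₀ μ (x - y) - dG₀ μ (x' - y)|
        ≤ ∑ y ∈ T.filter (fun y => 2 * h ≤ supNorm (x' - y)), d * h * (C₂ * 2 ^ d / nrm (x' - y) ^ d) := Finset.sum_le_sum hfar_pt
      _ = d * h * (C₂ * 2 ^ d) * ∑ y ∈ T.filter (fun y => 2 * h ≤ supNorm (x' - y)), 1 / nrm (x' - y) ^ d := by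
          rw [Finset.mul_sum]
          exact Finset.sum_congr rfl fun y _ => by ring
      _ ≤ d * h * (C₂ * 2 ^ d) * ∑ z ∈ (cube (0 : Site d) (3 * R + 3)).filter (fun z => 2 * h ≤ supNorm z), 1 / nrm z ^ d := by
          apply mul_le_mul_of_nonneg_left _ (by positivity)
          refine sum_reflect_le x' _ _ (fun z => 1 / nrm z ^ d) (fun z => one_div_nonneg.mpr (pow_nonneg (nrm_pos z).le _)) ?_
          intro y hy
          rw [Finset.mem_filter] at hy ⊢
          refine ⟨?_, hy.2⟩
          rw [mem_cube_zero_iff]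
          have h1 : supNorm (x' - y) ≤ supNorm (x' - c) + supNorm (c - y) := by
            simpa using supNorm_add_le (x' - c) (c - y)
          have h2 : supNorm (c - y) = supNorm (y - c) := by rw [← supNorm_neg, neg_sub]
          have h3 : supNorm (y - c) ≤ R + 1 := (Beta.PoissonInterior.mem_cube_iff_supNorm).1 hy.1
          omega
      _ ≤ d * h * (C₂ * 2 ^ d) * (2 * d * 3 ^ (d - 1) * (1 + Real.posLog (((3 * R + 3 : ℕ) : ℝ) / ((2 * h : ℕ) : ℝ)))) :=
          mul_le_mul_of_nonneg_left (sum_cube_far_inv_nrm_pow_le hd0 _ _ (by omega)) (by positivity)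
  -- NEAR FIELD: `|x′ − y|_∞ < 2h`
  have hnear_sum : ∑ y ∈ T.filter (fun y => ¬ 2 * h ≤ supNorm (x' - y)), |dG₀ μ (x - y) - dG₀ μ (x' - y)|
      ≤ C₁ * (1 + 2 * d * 3 ^ (d - 1) * ((3 * h : ℕ) : ℝ)) + C₁ * (1 + 2 * d * 3 ^ (d - 1) * ((2 * h : ℕ) : ℝ)) := by
    have hKb : ∀ v : Site d, |dG₀ μ v| ≤ C₁ / nrm v ^ (d - 1) := fun v => (hG v μ).1
    calc ∑ y ∈ T.filter (fun y => ¬ 2 * h ≤ supNorm (x' - y)), |dG₀ μ (x - y) - dG₀ μ (x' - y)|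
        ≤ ∑ y ∈ T.filter (fun y => ¬ 2 * h ≤ supNorm (x' - y)), (C₁ * (1 / nrm (x - y) ^ (d - 1)) + C₁ * (1 / nrm (x' - y) ^ (d - 1))) :=
          Finset.sum_le_sum fun y _ => by
            calc |dG₀ μ (x - y) - dG₀ μ (x' - y)| ≤ |dG₀ μ (x - y)| + |dG₀ μ (x' - y)| := abs_sub _ _
              _ ≤ C₁ / nrm (x - y) ^ (d - 1) + C₁ / nrm (x' - y) ^ (d - 1) := add_le_add (hKb _) (hKb _)
              _ = _ := by ring
      _ = C₁ * ∑ y ∈ T.filter (fun y => ¬ 2 * h ≤ supNorm (x' - y)), 1 / nrm (x - y) ^ (d - 1)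
          + C₁ * ∑ y ∈ T.filter (fun y => ¬ 2 * h ≤ supNorm (x' - y)), 1 / nrm (x' - y) ^ (d - 1) := by
          rw [Finset.sum_add_distrib, Finset.mul_sum, Finset.mul_sum]
      _ ≤ C₁ * ∑ z ∈ cube (0 : Site d) (3 * h), 1 / nrm z ^ (d - 1) + C₁ * ∑ z ∈ cube (0 : Site d) (2 * h), 1 / nrm z ^ (d - 1) := by
          apply add_le_add
          · apply mul_le_mul_of_nonneg_left _ hC₁
            refine sum_reflect_le x _ _ (fun z => 1 / nrm z ^ (d - 1)) (fun z => one_div_nonneg.mpr (pow_nonneg (nrm_pos z).le _)) ?_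
            intro y hy
            rw [Finset.mem_filter] at hy
            rw [mem_cube_zero_iff]
            have h1 : supNorm (x - y) ≤ supNorm (x - x') + supNorm (x' - y) := by
              simpa using supNorm_add_le (x - x') (x' - y)
            omega
          · apply mul_le_mul_of_nonneg_left _ hC₁
            refine sum_reflect_le x' _ _ (fun z => 1 / nrm z ^ (d - 1)) (fun z => one_div_nonneg.mpr (pow_nonneg (nrm_pos z).le _)) ?_
            intro y hy
            rw [Finset.mem_filter] at hy
            rw [mem_cube_zero_iff]
            omega
      _ ≤ C₁ * (1 + 2 * d * 3 ^ (d - 1) * ((3 * h : ℕ) : ℝ)) + C₁ * (1 + 2 * d * 3 ^ (d - 1) * ((2 * h : ℕ) : ℝ)) := by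
          have e1 : d - (d - 1) = 1 := Nat.sub_sub_self (by omega : 1 ≤ d)
          have h3 := sum_cube_inv_nrm_pow_le (d := d) hd0 (3 * h) (d - 1) le_rfl
          have h2 := sum_cube_inv_nrm_pow_le (d := d) hd0 (2 * h) (d - 1) le_rfl
          rw [e1, pow_one] at h3 h2
          exact add_le_add (mul_le_mul_of_nonneg_left h3 hC₁) (mul_le_mul_of_nonneg_left h2 hC₁)
  -- the whole kernel row
  have hposlog : Real.posLog (((3 * R + 3 : ℕ) : ℝ) / ((2 * h : ℕ) : ℝ)) ≤ 1 + Real.posLog (((R : ℝ) + 1) / h) := by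
    have : ((3 * R + 3 : ℕ) : ℝ) / ((2 * h : ℕ) : ℝ) = 3 / 2 * (((R : ℝ) + 1) / h) := by
      push_cast
      ring
    rw [this]
    exact posLog_three_halves_mul_le (by positivity)
  have hker : ∑ y ∈ T, |dG₀ μ (x - y) - dG₀ μ (x' - y)|
      ≤ (C₁ * (2 + 5 * (2 * d * 3 ^ (d - 1))) + 2 * d * (C₂ * 2 ^ d) * (2 * d * 3 ^ (d - 1))) * h
          * (1 + Real.posLog (((R : ℝ) + 1) / h)) := by
    rw [← Finset.sum_filter_add_sum_filter_not T (fun y => 2 * h ≤ supNorm (x' - y))]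
    have hP0 : 0 ≤ Real.posLog (((R : ℝ) + 1) / h) := Real.posLog_nonneg
    have hh0 : (0 : ℝ) ≤ h := by positivity
    -- far ≤ 2·d·C₂·2^d·A · h · (1 + P)
    have hfar' : ∑ y ∈ T.filter (fun y => 2 * h ≤ supNorm (x' - y)), |dG₀ μ (x - y) - dG₀ μ (x' - y)|
        ≤ 2 * d * (C₂ * 2 ^ d) * (2 * d * 3 ^ (d - 1)) * h * (1 + Real.posLog (((R : ℝ) + 1) / h)) := by
      refine hfar_sum.trans ?_
      have h1 : 1 + Real.posLog (((3 * R + 3 : ℕ) : ℝ) / ((2 * h : ℕ) : ℝ)) ≤ 2 * (1 + Real.posLog (((R : ℝ) + 1) / h)) := by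
        linarith
      calc (d : ℝ) * h * (C₂ * 2 ^ d) * (2 * d * 3 ^ (d - 1) * (1 + Real.posLog (((3 * R + 3 : ℕ) : ℝ) / ((2 * h : ℕ) : ℝ))))
          ≤ d * h * (C₂ * 2 ^ d) * (2 * d * 3 ^ (d - 1) * (2 * (1 + Real.posLog (((R : ℝ) + 1) / h)))) :=
            mul_le_mul_of_nonneg_left (mul_le_mul_of_nonneg_left h1 hA0) (by positivity)
        _ = 2 * d * (C₂ * 2 ^ d) * (2 * d * 3 ^ (d - 1)) * h * (1 + Real.posLog (((R : ℝ) + 1) / h)) := by ring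
    -- near ≤ C₁(2 + 5A) · h ≤ C₁(2 + 5A) · h · (1 + P)
    have hnear' : ∑ y ∈ T.filter (fun y => ¬ 2 * h ≤ supNorm (x' - y)), |dG₀ μ (x - y) - dG₀ μ (x' - y)|
        ≤ C₁ * (2 + 5 * (2 * d * 3 ^ (d - 1))) * h * (1 + Real.posLog (((R : ℝ) + 1) / h)) := by
      refine hnear_sum.trans ?_
      have h1 : C₁ * (1 + 2 * d * 3 ^ (d - 1) * ((3 * h : ℕ) : ℝ)) + C₁ * (1 + 2 * d * 3 ^ (d - 1) * ((2 * h : ℕ) : ℝ))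
          = C₁ * (2 + 5 * (2 * d * 3 ^ (d - 1)) * h) := by push_cast; ring
      have h2 : (2 : ℝ) + 5 * (2 * d * 3 ^ (d - 1)) * h ≤ (2 + 5 * (2 * d * 3 ^ (d - 1))) * h := by nlinarith
      rw [h1]
      calc C₁ * (2 + 5 * (2 * d * 3 ^ (d - 1)) * h) ≤ C₁ * ((2 + 5 * (2 * d * 3 ^ (d - 1))) * h) := mul_le_mul_of_nonneg_left h2 hC₁
        _ = C₁ * (2 + 5 * (2 * d * 3 ^ (d - 1))) * h * 1 := by ring
        _ ≤ C₁ * (2 + 5 * (2 * d * 3 ^ (d - 1))) * h * (1 + Real.posLog (((R : ℝ) + 1) / h)) :=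
            mul_le_mul_of_nonneg_left (by linarith) (by positivity)
    calc _ ≤ _ := add_le_add hfar' hnear'
      _ = _ := by ring
  -- duality
  have hM0 : 0 ≤ ((d : ℝ) * B' + D') * ((C₁ * (2 + 5 * (2 * d * 3 ^ (d - 1))) + 2 * d * (C₂ * 2 ^ d) * (2 * d * 3 ^ (d - 1))) * h
      * (1 + Real.posLog (((R : ℝ) + 1) / h))) := by positivity
  have hlap : ∀ y, ‖∑ ν, ((Z (y + e ν) κ - Z y κ) - (Z y κ - Z (y - e ν) κ))‖ ≤ d * B' + D' :=
    fun y => norm_lapVec_le Z hB0 hB hD y κ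
  have key : ‖(Z (x + e μ) κ - Z x κ) - (Z (x' + e μ) κ - Z x' κ)‖
      ≤ ((d : ℝ) * B' + D') * ((C₁ * (2 + 5 * (2 * d * 3 ^ (d - 1))) + 2 * d * (C₂ * 2 ^ d) * (2 * d * 3 ^ (d - 1))) * h
          * (1 + Real.posLog (((R : ℝ) + 1) / h))) := by
    refine NormedSpace.norm_le_dual_bound ℝ _ hM0 fun f => ?_
    have hg : ∀ y, y ∉ cube c R → (fun z => f (Z z κ)) y = 0 := fun y hy => by
      simp only [hZ y hy, Pi.zero_apply, map_zero]
    -- the dipole representation of one increment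
    have hrep : ∀ x₀ : Site d, f (Z (x₀ + e μ) κ - Z x₀ κ) = -∑ y ∈ T, dG₀ μ (x₀ - y) * latticeLaplacianZd (fun z => f (Z z κ)) y := by
      intro x₀
      have e1 : f (Z (x₀ + e μ) κ) = -∑ y ∈ T, G₀ (x₀ + e μ - y) * latticeLaplacianZd (fun z => f (Z z κ)) y :=
        green_rep hd c R (fun z => f (Z z κ)) hg (x₀ + e μ)
      have e2 : f (Z x₀ κ) = -∑ y ∈ T, G₀ (x₀ - y) * latticeLaplacianZd (fun z => f (Z z κ)) y :=
        green_rep hd c R (fun z => f (Z z κ)) hg x₀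
      rw [map_sub, e1, e2, neg_sub_neg, ← Finset.sum_sub_distrib, ← Finset.sum_neg_distrib]
      refine Finset.sum_congr rfl fun y _ => ?_
      have hy : G₀ (x₀ + e μ - y) = G₀ (x₀ - y + Pi.single μ 1) := by
        rw [show x₀ + e μ - y = x₀ - y + e μ by abel]
        rfl
      rw [hy, dG₀]
      ring
    have hdiff : f ((Z (x + e μ) κ - Z x κ) - (Z (x' + e μ) κ - Z x' κ))
        = -∑ y ∈ T, (dG₀ μ (x - y) - dG₀ μ (x' - y)) * latticeLaplacianZd (fun z => f (Z z κ)) y := by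
      rw [map_sub, hrep x, hrep x']
      simp only [sub_mul, Finset.sum_sub_distrib]
      ring
    rw [hdiff, norm_neg]
    calc ‖∑ y ∈ T, (dG₀ μ (x - y) - dG₀ μ (x' - y)) * latticeLaplacianZd (fun z => f (Z z κ)) y‖
        ≤ ∑ y ∈ T, ‖(dG₀ μ (x - y) - dG₀ μ (x' - y)) * latticeLaplacianZd (fun z => f (Z z κ)) y‖ := norm_sum_le _ _
      _ ≤ ∑ y ∈ T, |dG₀ μ (x - y) - dG₀ μ (x' - y)| * (((d : ℝ) * B' + D') * ‖f‖) :=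
          Finset.sum_le_sum fun y _ => by
            rw [norm_mul, Real.norm_eq_abs]
            refine mul_le_mul_of_nonneg_left ?_ (abs_nonneg _)
            rw [lap_dual_apply]
            calc ‖f (∑ ν, ((Z (y + e ν) κ - Z y κ) - (Z y κ - Z (y - e ν) κ)))‖
                ≤ ‖f‖ * ‖∑ ν, ((Z (y + e ν) κ - Z y κ) - (Z y κ - Z (y - e ν) κ))‖ := f.le_opNorm _
              _ ≤ ‖f‖ * (d * B' + D') := mul_le_mul_of_nonneg_left (hlap y) (norm_nonneg _)
              _ = (d * B' + D') * ‖f‖ := mul_comm _ _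
      _ = (∑ y ∈ T, |dG₀ μ (x - y) - dG₀ μ (x' - y)|) * (((d : ℝ) * B' + D') * ‖f‖) := by rw [Finset.sum_mul]
      _ ≤ ((C₁ * (2 + 5 * (2 * d * 3 ^ (d - 1))) + 2 * d * (C₂ * 2 ^ d) * (2 * d * 3 ^ (d - 1))) * h
          * (1 + Real.posLog (((R : ℝ) + 1) / h))) * (((d : ℝ) * B' + D') * ‖f‖) :=
          mul_le_mul_of_nonneg_right hker (by positivity)
      _ = _ := by ring
  -- relax `dB′ + D′ ≤ d(B′ + D′)` and add `Cg`
  have hS' : (d : ℝ) * B' + D' ≤ d * (B' + D') := by nlinarith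
  calc ‖(Z (x + e μ) κ - Z x κ) - (Z (x' + e μ) κ - Z x' κ)‖
      ≤ ((d : ℝ) * B' + D') * ((C₁ * (2 + 5 * (2 * d * 3 ^ (d - 1))) + 2 * d * (C₂ * 2 ^ d) * (2 * d * 3 ^ (d - 1))) * h
          * (1 + Real.posLog (((R : ℝ) + 1) / h))) := key
    _ ≤ (d * (B' + D')) * ((C₁ * (2 + 5 * (2 * d * 3 ^ (d - 1))) + 2 * d * (C₂ * 2 ^ d) * (2 * d * 3 ^ (d - 1))) * h
          * (1 + Real.posLog (((R : ℝ) + 1) / h))) := mul_le_mul_of_nonneg_right hS' (by positivity)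
    _ ≤ _ := by
        have hlog0' : 0 ≤ Real.posLog (((R : ℝ) + 1) / h) := Real.posLog_nonneg
        have hh0 : (0 : ℝ) ≤ h := by positivity
        nlinarith [mul_nonneg (mul_nonneg (mul_nonneg hCg hh0) (by positivity : (0:ℝ) ≤ 1 + Real.posLog (((R : ℝ) + 1) / h))) hBD]


/-! ## The same modulus in the block-aligned-box geometry of `NE7FlatSupLetterCompact` -/

omit [Fintype n] [DecidableEq n] in
/-- `log⁺((P + 1)∕h) ≤ 1 + log⁺(P∕h)` for `P ≥ 1`, `h > 0` (since `(P+1)∕h ≤ 2·(P∕h)` and `log⁺ 2 ≤ 1`). [folklore] -/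
theorem posLog_succ_div_le {P h : ℝ} (hP : 1 ≤ P) (hh : 0 < h) :
    Real.posLog ((P + 1) / h) ≤ 1 + Real.posLog (P / h) := by
  have h1 : Real.posLog ((P + 1) / h) ≤ Real.posLog (2 * (P / h)) :=
    Real.posLog_le_posLog (by positivity) (by rw [mul_div_assoc']; exact div_le_div_of_nonneg_right (by linarith) hh.le)
  have h2 : Real.posLog (2 * (P / h)) ≤ Real.posLog 2 + Real.posLog (P / h) := Real.posLog_mul
  have h3 : Real.posLog (2 : ℝ) ≤ 1 := by
    rw [Real.posLog_eq_log (by rw [abs_of_pos (by norm_num)]; norm_num)]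
    have := Real.log_le_sub_one_of_pos (show (0 : ℝ) < 2 by norm_num)
    linarith
  linarith

/-- **THE FLAT C¹ COMPACT LETTER, PART (ii), BOX GEOMETRY** (dimension `d + 1 ≥ 3`, every `L ≥ 1`, every `k`; `M = L^{k+1}`): `∃ K ≥ 0` (a function of `d`) such that
for every block-aligned box `M•c′ + [0, M·N′)^{d+1}` (`N′ ≥ 1`), every bond field `Z` vanishing off the box (in particular off its `4M`-interior, the support clause of
`NE7FlatSupLetterCompact.sup_flat_compact`), every `B′ ≥ 0` bounding `‖curlAt 1 Z (z + e_λ) μ ν − curlAt 1 Z z μ ν‖` (`μ ≠ ν`), every `D′` bounding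
`‖flatDiv Z (x + e_λ) − flatDiv Z x‖`, and all `x, x′, μ, κ` (`h := |x − x′|_∞ = supNorm (x − x′)`):
`‖(Z (x+e_μ) κ − Z x κ) − (Z (x′+e_μ) κ − Z x′ κ)‖ ≤ K·h·(1 + log⁺((L^{k+1}·N′)∕h))·(B′ + D′)` — the requested `C·|x − x′|·(1 + log(M N′∕|x − x′|))` form
(`log⁺ = log` on `1 ≤ h ≤ M N′`, `Real.posLog_eq_log`). [folklore] -/
theorem gradient_modulus_box (hd : 2 ≤ d) :
    ∃ K : ℝ, 0 ≤ K ∧ ∀ (L : ℕ), 1 ≤ L → ∀ (k : ℕ) (c' : Site (d + 1)) (N' : ℕ), 1 ≤ N' →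
      ∀ (Z : Site (d + 1) → Fin (d + 1) → Matrix n n ℂ),
      (∀ x : Site (d + 1), (∃ i, ¬ (((L ^ (k + 1) : ℕ) : ℤ) * c' i ≤ x i ∧
          x i < ((L ^ (k + 1) : ℕ) : ℤ) * c' i + ((L ^ (k + 1) : ℕ) : ℤ) * N')) → Z x = 0) →
      ∀ (B' : ℝ), 0 ≤ B' → (∀ (z : Site (d + 1)) (lam μ ν : Fin (d + 1)), μ ≠ ν →
        ‖curlAt (flat (d := d + 1) (n := n)) Z (z + e lam) μ ν - curlAt (flat (d := d + 1) (n := n)) Z z μ ν‖ ≤ B') →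
      ∀ (D' : ℝ), (∀ (x : Site (d + 1)) (lam : Fin (d + 1)), ‖flatDiv Z (x + e lam) - flatDiv Z x‖ ≤ D') →
      ∀ (x x' : Site (d + 1)) (μ κ : Fin (d + 1)),
        ‖(Z (x + e μ) κ - Z x κ) - (Z (x' + e μ) κ - Z x' κ)‖
          ≤ K * (supNorm (x - x') : ℝ) * (1 + Real.posLog (((L : ℝ) ^ (k + 1) * N') / supNorm (x - x'))) * (B' + D') := by
  obtain ⟨C, hC, h⟩ := gradient_modulus_cube (d := d + 1) (n := n) (by omega)
  refine ⟨2 * C, by positivity, fun L hL k c' N' hN' Z hZ B' hB0 hB D' hD x x' μ κ => ?_⟩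
  have hD0 : 0 ≤ D' := (norm_nonneg _).trans (hD x μ)
  have hBD : 0 ≤ B' + D' := by positivity
  -- the box lies in the cube of radius `M N′` about its corner
  have hZ' : ∀ y, y ∉ cube (fun i => ((L ^ (k + 1) : ℕ) : ℤ) * c' i) (L ^ (k + 1) * N') → Z y = 0 := by
    intro y hy
    refine hZ y ?_
    by_contra hall
    simp only [not_exists, not_not] at hall
    apply hy
    rw [mem_cube]
    intro i
    obtain ⟨h1, h2⟩ := hall i
    have hN0 : (0 : ℤ) ≤ ((L ^ (k + 1) : ℕ) : ℤ) * N' := by positivity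
    rw [abs_le]
    constructor <;> push_cast at h1 h2 hN0 ⊢ <;> linarith
  have hM1 : 1 ≤ L ^ (k + 1) * N' := Nat.one_le_iff_ne_zero.mpr (Nat.mul_ne_zero (pow_ne_zero _ (by omega)) (by omega))
  have hR1 : (1 : ℝ) ≤ ((L ^ (k + 1) * N' : ℕ) : ℝ) := by exact_mod_cast hM1
  have hRr : ((L ^ (k + 1) * N' : ℕ) : ℝ) = (L : ℝ) ^ (k + 1) * N' := by push_cast; ring
  have hmain := h _ _ Z hZ' B' hB0 hB D' hD x x' μ κ
  rcases Nat.eq_zero_or_pos (supNorm (x - x')) with hh0 | hh1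
  · have hxx : x = x' := sub_eq_zero.1 (supNorm_eq_zero_iff.1 hh0)
    rw [hh0]
    subst hxx
    simp
  have hh0r : (0 : ℝ) < supNorm (x - x') := by exact_mod_cast hh1
  have hlog : Real.posLog ((((L ^ (k + 1) * N' : ℕ) : ℝ) + 1) / supNorm (x - x'))
      ≤ 1 + Real.posLog (((L : ℝ) ^ (k + 1) * N') / supNorm (x - x')) := by
    rw [← hRr]
    exact posLog_succ_div_le hR1 hh0r
  have hP0 : 0 ≤ Real.posLog (((L : ℝ) ^ (k + 1) * N') / (supNorm (x - x') : ℝ)) := Real.posLog_nonneg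
  calc ‖(Z (x + e μ) κ - Z x κ) - (Z (x' + e μ) κ - Z x' κ)‖
      ≤ C * (supNorm (x - x') : ℝ) * (1 + Real.posLog ((((L ^ (k + 1) * N' : ℕ) : ℝ) + 1) / supNorm (x - x'))) * (B' + D') := hmain
    _ ≤ C * (supNorm (x - x') : ℝ) * (2 * (1 + Real.posLog (((L : ℝ) ^ (k + 1) * N') / supNorm (x - x')))) * (B' + D') := by
        apply mul_le_mul_of_nonneg_right _ hBD
        apply mul_le_mul_of_nonneg_left _ (by positivity)
        linarith
    _ = 2 * C * (supNorm (x - x') : ℝ) * (1 + Real.posLog (((L : ℝ) ^ (k + 1) * N') / supNorm (x - x'))) * (B' + D') := by ring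

end

end Summit.QuantumFields.BalabanUV.T4Continuum.NE7FlatGradientModulusCompact
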